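import Summits.MatrixMultiplication.MatrixMultiplication.Theorems.SoloInformedThirdRow

/-!
# THEOREM 8.20, Step 2 assembled: a poor family against an X-pair is bounded or half-typed into one kind

This work, §8.8 (T12)(f) Step 2 and C3-m2 §5.5 (gen 107). Setting as in `SoloInformedThirdRow`.

`Data.family_kinds`: let `j₁, j₂` be an X-pair (`a(·,j₁) ∼ v′` and `a(·,j₂) ∼ v` off the rows `E`, `b(j₁,·) ∼ v` off
the columns `F`, `|E|, |F| ≤ e`, `v ≁ v′`) and `P` a family of rows each class-constant together with `j₁` on a
common cell of size `≥ s` and `> e` (for `b`-poor rows such cells exist by pigeonhole). Then either one of the two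
bounds of `Data.third_row_kind` holds (`n·t·s ≤ r·|S⁰|` or `n·t′·(n − t − e) ≤ r·|S⁰|`), or at least half of `P` is
of ONE kind: there are exception sets `Ea j` (`|Ea j| ≤ t + e`) and `Fb j` (`|Fb j| ≤ t′`) off which the `a`-column
of every such `j` is `∼ p` and its `b`-row is `∼ q`, with `(p, q) = (v, v′)` (kind 𝓧) or `(v′, v)` (kind 𝓛) — exactly
the line data consumed by `Data.nearRect_lines` (THEOREM 8.19).
-/

namespace Summit.MatrixMultiplication.MatrixMultiplication.Theorems.TwistedTPP

namespace FibreLines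

variable {ι G : Type*} [AddCommGroup G]
variable {G₀ : Type*} [AddCommGroup G₀] {R : Type*}

/-- **THEOREM 8.20, Step 2 assembled.** [this work, §8.8 (T12)(f) Step 2; C3-m2 §5.5] -/
theorem Data.family_kinds [Fintype ι] [DecidableEq ι] [Fintype G₀] [DecidableEq G₀] [Fintype R]
    [DecidableEq R] (hG : ∀ x : G, x = -x → x = 0) (D : Data ι G) (Φ : Chart ι G₀) (κ : G → R)
    (hκ : ∀ x y, κ x = κ y → SignEq x y) (hsep : D.SepAll Φ) {j₁ j₂ : ι} {v v' : G}
    (hvv : ¬ SignEq v v') (E F : Finset ι) (e t t' s : ℕ) (hE : E.card ≤ e) (hF : F.card ≤ e)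
    (ha₁ : ∀ i, i ∉ E → SignEq (D.a i j₁) v') (ha₂ : ∀ i, i ∉ E → SignEq (D.a i j₂) v)
    (hb₁ : ∀ k, k ∉ F → SignEq (D.b j₁ k) v) (P : Finset ι)
    (hP : ∀ j'' ∈ P, ∃ Ks : Finset ι, ∃ w'' w : G, s ≤ Ks.card ∧ e < Ks.card ∧
      (∀ k ∈ Ks, SignEq (D.b j'' k) w'') ∧ ∀ k ∈ Ks, SignEq (D.b j₁ k) w) :
    Fintype.card ι * t * s ≤ Fintype.card R * Fintype.card G₀ ∨
    Fintype.card ι * t' * (Fintype.card ι - t - e) ≤ Fintype.card R * Fintype.card G₀ ∨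
    ∃ K ⊆ P, P.card ≤ 2 * K.card ∧ ∃ Ea Fb : ι → Finset ι,
      (∀ j ∈ K, (Ea j).card ≤ t + e ∧ (Fb j).card ≤ t') ∧
      ((∀ j ∈ K, (∀ i, i ∉ Ea j → SignEq (D.a i j) v) ∧ ∀ k, k ∉ Fb j → SignEq (D.b j k) v') ∨
        (∀ j ∈ K, (∀ i, i ∉ Ea j → SignEq (D.a i j) v') ∧ ∀ k, k ∉ Fb j → SignEq (D.b j k) v)) := by
  classical
  by_cases hb1 : Fintype.card ι * t * s ≤ Fintype.card R * Fintype.card G₀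
  · exact Or.inl hb1
  by_cases hb2 : Fintype.card ι * t' * (Fintype.card ι - t - e) ≤ Fintype.card R * Fintype.card G₀
  · exact Or.inr (Or.inl hb2)
  right; right
  -- the kind predicates
  set kind : G → G → ι → Prop := fun p q j => ∃ Ig Kg : Finset ι,
    Fintype.card ι ≤ Ig.card + t + e ∧ Fintype.card ι < Kg.card + t' ∧
      (∀ i ∈ Ig, SignEq (D.a i j) p) ∧ ∀ k ∈ Kg, SignEq (D.b j k) q with hkind
  have hall : ∀ j ∈ P, kind v v' j ∨ kind v' v j := by
    intro j hj
    obtain ⟨Ks, w'', w, hs, he, hj'', hj₁⟩ := hP j hj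
    rcases D.third_row_kind hG Φ κ hκ hsep hvv E F Ks e t t' hE hF ha₁ ha₂ hb₁ he hj'' hj₁ with
      h | h | h | h
    · exact absurd ((Nat.mul_le_mul_left _ hs).trans h) hb1
    · exact absurd h hb2
    · exact Or.inl h
    · exact Or.inr h
  set KX : Finset ι := P.filter fun j => kind v v' j with hKX
  set KL : Finset ι := P.filter fun j => kind v' v j with hKL
  have hcover : P ⊆ KX ∪ KL := by
    intro j hj
    rcases hall j hj with h | h
    · exact Finset.mem_union_left _ (Finset.mem_filter.2 ⟨hj, h⟩)
    · exact Finset.mem_union_right _ (Finset.mem_filter.2 ⟨hj, h⟩)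
  have hcard : P.card ≤ KX.card + KL.card :=
    (Finset.card_le_card hcover).trans (Finset.card_union_le _ _)
  -- exception sets from a kind witness
  have extract : ∀ (p q : G) (K : Finset ι), (∀ j ∈ K, kind p q j) → ∃ Ea Fb : ι → Finset ι,
      (∀ j ∈ K, (Ea j).card ≤ t + e ∧ (Fb j).card ≤ t') ∧
        ∀ j ∈ K, (∀ i, i ∉ Ea j → SignEq (D.a i j) p) ∧ ∀ k, k ∉ Fb j → SignEq (D.b j k) q := by
    intro p q K hK
    refine ⟨fun j => if h : kind p q j then h.chooseᶜ else ∅,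
      fun j => if h : kind p q j then h.choose_spec.chooseᶜ else ∅, fun j hj => ?_, fun j hj => ?_⟩
    · have h := hK j hj
      obtain ⟨hI, hKg, -, -⟩ := h.choose_spec.choose_spec
      simp only [dif_pos h, Finset.card_compl]
      constructor <;> omega
    · have h := hK j hj
      obtain ⟨-, -, hIa, hKb⟩ := h.choose_spec.choose_spec
      simp only [dif_pos h]
      refine ⟨fun i hi => hIa i ?_, fun k hk => hKb k ?_⟩
      · by_contra hc; exact hi (Finset.mem_compl.2 hc)
      · by_contra hc; exact hk (Finset.mem_compl.2 hc)
  by_cases hX : P.card ≤ 2 * KX.card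
  · obtain ⟨Ea, Fb, h1, h2⟩ := extract v v' KX fun j hj => (Finset.mem_filter.1 hj).2
    exact ⟨KX, Finset.filter_subset _ _, hX, Ea, Fb, h1, Or.inl h2⟩
  · obtain ⟨Ea, Fb, h1, h2⟩ := extract v' v KL fun j hj => (Finset.mem_filter.1 hj).2
    exact ⟨KL, Finset.filter_subset _ _, by omega, Ea, Fb, h1, Or.inr h2⟩

end FibreLines

end Summit.MatrixMultiplication.MatrixMultiplication.Theorems.TwistedTPP
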